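import Summits.QuantumFields.YangMills.Theorems.SwapVirialDeficitSectorLaplaceTipCoreAssembly
import Summits.QuantumFields.YangMills.Theorems.SwapVirialDeficitSectorLaplaceTipCoreRegionsPrelims
import HarnessLib

/-!
# THE LEADER-LAYER MERGE `leaderLayer_aligned`: three REGION SOCKETS (w2's ORIG ∕ PX ∕ PY of the aligned-rotation assembly) ⟹ the leader-layer socket `hLLm`
# (cell ym-idea-1, skeleton ➎ v14, `stub_core_tip`, socket (hCore); LEAD rulings (B8)/(B9) 2026-09-01; LEAD seat ym-line-sfw-p2 g100, free-hands support of
# ⟨stmt-QuantumFields-24197⟩ `SwapVirialDeficit.SwapGluedStiffness`)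

SOCKETS FIRST.  The chain of record is: region sockets (`leaderLayer_ORIG` — LEAD; `leaderLayer_PX`, `leaderLayer_PY` — w2 g61) ⟹ THIS FILE ⟹ `hLLm` ⟹
✓`hubIntegral_hubAt_core_ceiling_of_leaderLayer_meas` (✓`…TipCoreAssemblyMeas`) ⟹ g49's frozen (hCore) binder ⟹ `stub_core_tip_of_core` ⟹ skeleton ➎.
A REGION SOCKET for a family `S : (L : ℕ) → ℝ → Set ((Fin 3 → ℝ) × (Fin 3 → ℝ))` of leader-pair regions is the statement of `hLLm` with the outer `lintegral`
RESTRICTED to `S L δt` (restriction, not an indicator inside: lower integrals split over a cover by ✓`lintegral_union_le` with no measurability).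
* `lintegral_le_of_cover3'` (generic three-set cover split), `leaderRegions_cover` (ORIG ∪ PX ∪ PY = everything, squared letters `normSq3`);
* ★★★ `leaderLayer_aligned` — sockets for `S₁, S₂, S₃` + cover ⟹ `hLLm` (constants: `Φ = Σ Φᵢ`, exponents by `max`, tails merged by ✓`three_tails_le` with
  `C = max(Tᵢ, 0)`, thresholds `K₁ = Σ`, `DR = Σ`).

HONEST LABEL: bookkeeping; the three region sockets are OPEN ⟹ `hLLm`, (hCore), `stub_core_tip`, ⟨24197⟩ ∕ ⟨24194⟩ OPEN; own crux ⟨22884⟩ `LargeFieldMassRefinementTail`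
OPEN (blocked-on ⟨19935⟩); the Yang–Mills mass gap is NOT proved; no summit is proved by a line.  THEOREMS ONLY (0 `def`, 0 `sorry`, no instance, no notation),
standard axioms.  `--supports stmt-QuantumFields-24197`.  References: [cite: Luscher1983, §2]; [folklore].
-/

set_option autoImplicit false
set_option synthInstance.maxSize 1024

noncomputable section

open MeasureTheory Quaternion Set Module
open scoped Quaternion BigOperators ENNReal InnerProductSpace
open Literature.MathematicalPhysics.QuantumLattice
open Literature.MathematicalPhysics.QuantumFieldTheory hiding SU2

namespace Summit.QuantumFields.YangMills.Theorems.SwapVirialDeficit.SectorLaplace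

open Summit.QuantumFields.YangMills.Theorems.FemtoTransferGap
open Summit.QuantumFields.YangMills.Theorems.FemtoTransferGap.TT
open Summit.QuantumFields.YangMills.Theorems.VirialFluxGap.RingDeficit
open Summit.QuantumFields.YangMills.Theorems.SwapVirialDeficit.SwapRing
open Summit.QuantumFields.YangMills.Theorems.SwapVirialDeficit.BlowUpRing
open Summit.QuantumFields.YangMills.Theorems.SwapVirialDeficit.Gnomonic (piWeight gnomonicWeight normSq3)

/-! ## §1 Covers -/

/-- A three-set cover splits a `lintegral` (any measure space): `∫⁻ f ≤ ∫⁻_{S₁} f + ∫⁻_{S₂} f + ∫⁻_{S₃} f`, no measurability needed. [folklore] -/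
theorem lintegral_le_of_cover3' {α : Type*} [MeasurableSpace α] (μ : Measure α) (f : α → ℝ≥0∞) {S₁ S₂ S₃ : Set α} (h : ∀ x, x ∈ S₁ ∪ S₂ ∪ S₃) :
    ∫⁻ x, f x ∂μ ≤ (∫⁻ x in S₁, f x ∂μ) + (∫⁻ x in S₂, f x ∂μ) + ∫⁻ x in S₃, f x ∂μ := by
  have hu : (Set.univ : Set α) ⊆ S₁ ∪ S₂ ∪ S₃ := fun x _ => h x
  calc ∫⁻ x, f x ∂μ = ∫⁻ x in Set.univ, f x ∂μ := by rw [Measure.restrict_univ]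
    _ ≤ ∫⁻ x in S₁ ∪ S₂ ∪ S₃, f x ∂μ := lintegral_mono_set hu
    _ ≤ (∫⁻ x in S₁ ∪ S₂, f x ∂μ) + ∫⁻ x in S₃, f x ∂μ := lintegral_union_le _ _ _
    _ ≤ _ := by gcongr; exact lintegral_union_le _ _ _

/-- ★ w2's leader-pair regions cover everything: with `s² = (1+δt²)⁻¹`, `|x|²,|y|² ≤ s²` (ORIG) or `|y|² ≤ |x|² > s²` (PX) or `|x|² < |y|² > s²` (PY). [folklore] -/
theorem leaderRegions_cover (δt : ℝ) (xy : (Fin 3 → ℝ) × (Fin 3 → ℝ)) :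
    xy ∈ {xy : (Fin 3 → ℝ) × (Fin 3 → ℝ) | normSq3 xy.1 ≤ (1 + δt ^ 2)⁻¹ ∧ normSq3 xy.2 ≤ (1 + δt ^ 2)⁻¹} ∪
        {xy : (Fin 3 → ℝ) × (Fin 3 → ℝ) | normSq3 xy.2 ≤ normSq3 xy.1 ∧ (1 + δt ^ 2)⁻¹ < normSq3 xy.1} ∪
        {xy : (Fin 3 → ℝ) × (Fin 3 → ℝ) | normSq3 xy.1 < normSq3 xy.2 ∧ (1 + δt ^ 2)⁻¹ < normSq3 xy.2} := by
  simp only [Set.mem_union, Set.mem_setOf_eq]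
  by_cases hx : normSq3 xy.1 ≤ (1 + δt ^ 2)⁻¹
  · by_cases hy : normSq3 xy.2 ≤ (1 + δt ^ 2)⁻¹
    · exact Or.inl (Or.inl ⟨hx, hy⟩)
    · right; exact ⟨lt_of_le_of_lt hx (not_le.1 hy), not_le.1 hy⟩
  · rcases le_or_gt (normSq3 xy.2) (normSq3 xy.1) with h | h
    · exact Or.inl (Or.inr ⟨h, not_le.1 hx⟩)
    · right; exact ⟨h, (not_le.1 hx).trans h⟩

/-! ## §2 The merge -/

set_option maxHeartbeats 1600000 in
/-- ★★★ **THE LEADER-LAYER MERGE**: region sockets for three leader-pair region families `S₁ S₂ S₃` covering everything (for every `L, δt`) give the leader-layer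
socket `hLLm` of ✓`hubIntegral_hubAt_core_ceiling_of_leaderLayer_meas`. [cite: Luscher1983, §2] -/
theorem leaderLayer_aligned (S₁ S₂ S₃ : (L : ℕ) → ℝ → Set ((Fin 3 → ℝ) × (Fin 3 → ℝ)))
    (hcover : ∀ (L : ℕ) (δt : ℝ) (xy : (Fin 3 → ℝ) × (Fin 3 → ℝ)), xy ∈ S₁ L δt ∪ S₂ L δt ∪ S₃ L δt)
    (h₁ : (∃ Φ : ℝ, 0 < Φ ∧ ∃ cΦ : ℕ, ∃ CT : ℝ, ∃ pT : ℕ, ∃ QT : ℝ, 0 < QT ∧ ∃ K₁ : ℝ, 0 < K₁ ∧ ∃ k₁ : ℕ, ∃ DR : ℝ, 1 ≤ DR ∧ ∃ dR : ℕ,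
      ∀ (L : ℕ) [NeZero L] (b : ℝ), K₁ * (L : ℝ) ^ k₁ ≤ b → ∀ ε : GnoSign L, GoodSign ε → ∀ δt : ℝ, DR * (L : ℝ) ^ dR ≤ δt →
        ∀ (A0 : GnoCoord L → GnoFol L →ₗ[ℝ] GnoFol L), (∀ η, (A0 η).IsSymmetric) →
          (∀ η (y : GnoFol L), ⟪A0 η y, y⟫_ℝ = iteratedFDeriv ℝ 2 (fun y' : GnoFol L => gnoDeficit z₀ (fun _ => 1) ((1 : ℝ) : ℍ) ε (η + gnoFolEmb y')) 0 (fun _ => y)) →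
          (∀ η (y : GnoFol L), ⟪A0 η y, y⟫_ℝ = iteratedDeriv 2 (fun s : ℝ => gnoDeficit (fun _ => false) (fun _ => 1) ((1 : ℝ) : ℍ) ε (η + s • gnoFolEmb y)) 0) →
          (∀ η (y : GnoFol L), ⟪A0 η y, y⟫_ℝ = iteratedFDeriv ℝ 2 (gnoDeficit z₀ (fun _ => 1) ((1 : ℝ) : ℍ) ε) η (fun _ => gnoFolEmb y)) →
          (Measurable fun q : GnoCoord L × GnoFol L => ⟪A0 q.1 q.2, q.2⟫_ℝ) →
          ∫⁻ xy in S₁ L δt, ∫⁻ z : Fin 3 → ℝ, ENNReal.ofReal (gnomonicWeight xy.1 * gnomonicWeight xy.2 * gnomonicWeight z) *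
              ∫⁻ F : Fol L → Fin 3 → ℝ,
                ENNReal.ofReal (Real.exp (-(b * gnoDeficit (fun _ => false) (fun _ => 1) (hubAt δt 1) ε ((xy, (z, F)) : GnoCoord L))) * piWeight F) ≤
            ENNReal.ofReal (Φ * (L : ℝ) ^ cΦ * (2 * Real.pi / b) ^ ((7 : ℝ) / 2) *
                (2 * Real.pi / ((1 - 1 / (2 * (finrank ℝ (GnoFol L) : ℝ))) * b)) ^ ((finrank ℝ (GnoFol L) : ℝ) / 2)) *
              (∫⁻ p : ℝ × ℝ, ENNReal.ofReal ((1 + δt ^ 2) ^ 2 / (1 + (p.1 ^ 2 / (1 + p.1 ^ 2) + p.2 ^ 2 / (1 + p.2 ^ 2)) * (1 + δt ^ 2)) *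
                ((1 + p.1 ^ 2)⁻¹ * (1 + p.2 ^ 2)⁻¹ / Real.sqrt (LinearMap.det (A0 (gnoBase p.1 p.2)))))) +
            ENNReal.ofReal (Real.exp (CT * (L : ℝ) ^ pT - b / (QT * (L : ℝ) ^ pT)))))
    (h₂ : (∃ Φ : ℝ, 0 < Φ ∧ ∃ cΦ : ℕ, ∃ CT : ℝ, ∃ pT : ℕ, ∃ QT : ℝ, 0 < QT ∧ ∃ K₁ : ℝ, 0 < K₁ ∧ ∃ k₁ : ℕ, ∃ DR : ℝ, 1 ≤ DR ∧ ∃ dR : ℕ,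
      ∀ (L : ℕ) [NeZero L] (b : ℝ), K₁ * (L : ℝ) ^ k₁ ≤ b → ∀ ε : GnoSign L, GoodSign ε → ∀ δt : ℝ, DR * (L : ℝ) ^ dR ≤ δt →
        ∀ (A0 : GnoCoord L → GnoFol L →ₗ[ℝ] GnoFol L), (∀ η, (A0 η).IsSymmetric) →
          (∀ η (y : GnoFol L), ⟪A0 η y, y⟫_ℝ = iteratedFDeriv ℝ 2 (fun y' : GnoFol L => gnoDeficit z₀ (fun _ => 1) ((1 : ℝ) : ℍ) ε (η + gnoFolEmb y')) 0 (fun _ => y)) →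
          (∀ η (y : GnoFol L), ⟪A0 η y, y⟫_ℝ = iteratedDeriv 2 (fun s : ℝ => gnoDeficit (fun _ => false) (fun _ => 1) ((1 : ℝ) : ℍ) ε (η + s • gnoFolEmb y)) 0) →
          (∀ η (y : GnoFol L), ⟪A0 η y, y⟫_ℝ = iteratedFDeriv ℝ 2 (gnoDeficit z₀ (fun _ => 1) ((1 : ℝ) : ℍ) ε) η (fun _ => gnoFolEmb y)) →
          (Measurable fun q : GnoCoord L × GnoFol L => ⟪A0 q.1 q.2, q.2⟫_ℝ) →
          ∫⁻ xy in S₂ L δt, ∫⁻ z : Fin 3 → ℝ, ENNReal.ofReal (gnomonicWeight xy.1 * gnomonicWeight xy.2 * gnomonicWeight z) *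
              ∫⁻ F : Fol L → Fin 3 → ℝ,
                ENNReal.ofReal (Real.exp (-(b * gnoDeficit (fun _ => false) (fun _ => 1) (hubAt δt 1) ε ((xy, (z, F)) : GnoCoord L))) * piWeight F) ≤
            ENNReal.ofReal (Φ * (L : ℝ) ^ cΦ * (2 * Real.pi / b) ^ ((7 : ℝ) / 2) *
                (2 * Real.pi / ((1 - 1 / (2 * (finrank ℝ (GnoFol L) : ℝ))) * b)) ^ ((finrank ℝ (GnoFol L) : ℝ) / 2)) *
              (∫⁻ p : ℝ × ℝ, ENNReal.ofReal ((1 + δt ^ 2) ^ 2 / (1 + (p.1 ^ 2 / (1 + p.1 ^ 2) + p.2 ^ 2 / (1 + p.2 ^ 2)) * (1 + δt ^ 2)) *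
                ((1 + p.1 ^ 2)⁻¹ * (1 + p.2 ^ 2)⁻¹ / Real.sqrt (LinearMap.det (A0 (gnoBase p.1 p.2)))))) +
            ENNReal.ofReal (Real.exp (CT * (L : ℝ) ^ pT - b / (QT * (L : ℝ) ^ pT)))))
    (h₃ : (∃ Φ : ℝ, 0 < Φ ∧ ∃ cΦ : ℕ, ∃ CT : ℝ, ∃ pT : ℕ, ∃ QT : ℝ, 0 < QT ∧ ∃ K₁ : ℝ, 0 < K₁ ∧ ∃ k₁ : ℕ, ∃ DR : ℝ, 1 ≤ DR ∧ ∃ dR : ℕ,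
      ∀ (L : ℕ) [NeZero L] (b : ℝ), K₁ * (L : ℝ) ^ k₁ ≤ b → ∀ ε : GnoSign L, GoodSign ε → ∀ δt : ℝ, DR * (L : ℝ) ^ dR ≤ δt →
        ∀ (A0 : GnoCoord L → GnoFol L →ₗ[ℝ] GnoFol L), (∀ η, (A0 η).IsSymmetric) →
          (∀ η (y : GnoFol L), ⟪A0 η y, y⟫_ℝ = iteratedFDeriv ℝ 2 (fun y' : GnoFol L => gnoDeficit z₀ (fun _ => 1) ((1 : ℝ) : ℍ) ε (η + gnoFolEmb y')) 0 (fun _ => y)) →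
          (∀ η (y : GnoFol L), ⟪A0 η y, y⟫_ℝ = iteratedDeriv 2 (fun s : ℝ => gnoDeficit (fun _ => false) (fun _ => 1) ((1 : ℝ) : ℍ) ε (η + s • gnoFolEmb y)) 0) →
          (∀ η (y : GnoFol L), ⟪A0 η y, y⟫_ℝ = iteratedFDeriv ℝ 2 (gnoDeficit z₀ (fun _ => 1) ((1 : ℝ) : ℍ) ε) η (fun _ => gnoFolEmb y)) →
          (Measurable fun q : GnoCoord L × GnoFol L => ⟪A0 q.1 q.2, q.2⟫_ℝ) →
          ∫⁻ xy in S₃ L δt, ∫⁻ z : Fin 3 → ℝ, ENNReal.ofReal (gnomonicWeight xy.1 * gnomonicWeight xy.2 * gnomonicWeight z) *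
              ∫⁻ F : Fol L → Fin 3 → ℝ,
                ENNReal.ofReal (Real.exp (-(b * gnoDeficit (fun _ => false) (fun _ => 1) (hubAt δt 1) ε ((xy, (z, F)) : GnoCoord L))) * piWeight F) ≤
            ENNReal.ofReal (Φ * (L : ℝ) ^ cΦ * (2 * Real.pi / b) ^ ((7 : ℝ) / 2) *
                (2 * Real.pi / ((1 - 1 / (2 * (finrank ℝ (GnoFol L) : ℝ))) * b)) ^ ((finrank ℝ (GnoFol L) : ℝ) / 2)) *
              (∫⁻ p : ℝ × ℝ, ENNReal.ofReal ((1 + δt ^ 2) ^ 2 / (1 + (p.1 ^ 2 / (1 + p.1 ^ 2) + p.2 ^ 2 / (1 + p.2 ^ 2)) * (1 + δt ^ 2)) *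
                ((1 + p.1 ^ 2)⁻¹ * (1 + p.2 ^ 2)⁻¹ / Real.sqrt (LinearMap.det (A0 (gnoBase p.1 p.2)))))) +
            ENNReal.ofReal (Real.exp (CT * (L : ℝ) ^ pT - b / (QT * (L : ℝ) ^ pT))))) :
    (∃ Φ : ℝ, 0 < Φ ∧ ∃ cΦ : ℕ, ∃ CT : ℝ, ∃ pT : ℕ, ∃ QT : ℝ, 0 < QT ∧ ∃ K₁ : ℝ, 0 < K₁ ∧ ∃ k₁ : ℕ, ∃ DR : ℝ, 1 ≤ DR ∧ ∃ dR : ℕ,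
      ∀ (L : ℕ) [NeZero L] (b : ℝ), K₁ * (L : ℝ) ^ k₁ ≤ b → ∀ ε : GnoSign L, GoodSign ε → ∀ δt : ℝ, DR * (L : ℝ) ^ dR ≤ δt →
        ∀ (A0 : GnoCoord L → GnoFol L →ₗ[ℝ] GnoFol L), (∀ η, (A0 η).IsSymmetric) →
          (∀ η (y : GnoFol L), ⟪A0 η y, y⟫_ℝ = iteratedFDeriv ℝ 2 (fun y' : GnoFol L => gnoDeficit z₀ (fun _ => 1) ((1 : ℝ) : ℍ) ε (η + gnoFolEmb y')) 0 (fun _ => y)) →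
          (∀ η (y : GnoFol L), ⟪A0 η y, y⟫_ℝ = iteratedDeriv 2 (fun s : ℝ => gnoDeficit (fun _ => false) (fun _ => 1) ((1 : ℝ) : ℍ) ε (η + s • gnoFolEmb y)) 0) →
          (∀ η (y : GnoFol L), ⟪A0 η y, y⟫_ℝ = iteratedFDeriv ℝ 2 (gnoDeficit z₀ (fun _ => 1) ((1 : ℝ) : ℍ) ε) η (fun _ => gnoFolEmb y)) →
          (Measurable fun q : GnoCoord L × GnoFol L => ⟪A0 q.1 q.2, q.2⟫_ℝ) →
          ∫⁻ xy : (Fin 3 → ℝ) × (Fin 3 → ℝ), ∫⁻ z : Fin 3 → ℝ, ENNReal.ofReal (gnomonicWeight xy.1 * gnomonicWeight xy.2 * gnomonicWeight z) *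
              ∫⁻ F : Fol L → Fin 3 → ℝ,
                ENNReal.ofReal (Real.exp (-(b * gnoDeficit (fun _ => false) (fun _ => 1) (hubAt δt 1) ε ((xy, (z, F)) : GnoCoord L))) * piWeight F) ≤
            ENNReal.ofReal (Φ * (L : ℝ) ^ cΦ * (2 * Real.pi / b) ^ ((7 : ℝ) / 2) *
                (2 * Real.pi / ((1 - 1 / (2 * (finrank ℝ (GnoFol L) : ℝ))) * b)) ^ ((finrank ℝ (GnoFol L) : ℝ) / 2)) *
              (∫⁻ p : ℝ × ℝ, ENNReal.ofReal ((1 + δt ^ 2) ^ 2 / (1 + (p.1 ^ 2 / (1 + p.1 ^ 2) + p.2 ^ 2 / (1 + p.2 ^ 2)) * (1 + δt ^ 2)) *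
                ((1 + p.1 ^ 2)⁻¹ * (1 + p.2 ^ 2)⁻¹ / Real.sqrt (LinearMap.det (A0 (gnoBase p.1 p.2)))))) +
            ENNReal.ofReal (Real.exp (CT * (L : ℝ) ^ pT - b / (QT * (L : ℝ) ^ pT)))) := by
  obtain ⟨C₁, hC₁, c₁, T₁, p₁, Q₁, hQ₁, K₁, hK₁, k₁, D₁, hD₁, d₁, H₁⟩ := h₁
  obtain ⟨C₂, hC₂, c₂, T₂, p₂, Q₂, hQ₂, K₂, hK₂, k₂, D₂, hD₂, d₂, H₂⟩ := h₂
  obtain ⟨C₃, hC₃, c₃, T₃, p₃, Q₃, hQ₃, K₃, hK₃, k₃, D₃, hD₃, d₃, H₃⟩ := h₃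
  refine ⟨C₁ + C₂ + C₃, by positivity, max c₁ (max c₂ c₃), max (max T₁ (max T₂ T₃)) 0 + 2, max p₁ (max p₂ p₃), max Q₁ (max Q₂ Q₃),
    lt_max_of_lt_left hQ₁, K₁ + K₂ + K₃, by positivity, max k₁ (max k₂ k₃), D₁ + D₂ + D₃, by linarith, max d₁ (max d₂ d₃), ?_⟩
  intro L _ b hb ε hε δt hδt A0 hA0s hA0yy hA0ray hA0amb hAm
  have hL1 : (1 : ℝ) ≤ (L : ℝ) := by exact_mod_cast NeZero.one_le
  have hL0 : (0 : ℝ) < L := by linarith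
  have hLpow : ∀ {m n : ℕ}, m ≤ n → (L : ℝ) ^ m ≤ (L : ℝ) ^ n := fun h => pow_le_pow_right₀ hL1 h
  have hLp0 : ∀ n : ℕ, 0 < (L : ℝ) ^ n := fun n => pow_pos hL0 n
  have hbpos : 0 < b := lt_of_lt_of_le (by positivity) hb
  have hb₁ : K₁ * (L : ℝ) ^ k₁ ≤ b := le_trans (mul_le_mul (by linarith) (hLpow (le_max_left _ _)) (hLp0 _).le (by positivity)) hb
  have hb₂ : K₂ * (L : ℝ) ^ k₂ ≤ b :=
    le_trans (mul_le_mul (by linarith) (hLpow ((le_max_left _ _).trans (le_max_right _ _))) (hLp0 _).le (by positivity)) hb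
  have hb₃ : K₃ * (L : ℝ) ^ k₃ ≤ b :=
    le_trans (mul_le_mul (by linarith) (hLpow ((le_max_right _ _).trans (le_max_right _ _))) (hLp0 _).le (by positivity)) hb
  have hδt₁ : D₁ * (L : ℝ) ^ d₁ ≤ δt := le_trans (mul_le_mul (by linarith) (hLpow (le_max_left _ _)) (hLp0 _).le (by positivity)) hδt
  have hδt₂ : D₂ * (L : ℝ) ^ d₂ ≤ δt :=
    le_trans (mul_le_mul (by linarith) (hLpow ((le_max_left _ _).trans (le_max_right _ _))) (hLp0 _).le (by positivity)) hδt
  have hδt₃ : D₃ * (L : ℝ) ^ d₃ ≤ δt :=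
    le_trans (mul_le_mul (by linarith) (hLpow ((le_max_right _ _).trans (le_max_right _ _))) (hLp0 _).le (by positivity)) hδt
  have R₁ := H₁ L b hb₁ ε hε δt hδt₁ A0 hA0s hA0yy hA0ray hA0amb hAm
  have R₂ := H₂ L b hb₂ ε hε δt hδt₂ A0 hA0s hA0yy hA0ray hA0amb hAm
  have R₃ := H₃ L b hb₃ ε hε δt hδt₃ A0 hA0s hA0yy hA0ray hA0amb hAm
  clear H₁ H₂ H₃
  -- names for the common pieces
  generalize hXdef : (2 * Real.pi / b) ^ ((7 : ℝ) / 2) = X at R₁ R₂ R₃ ⊢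
  generalize hYdef : (2 * Real.pi / ((1 - 1 / (2 * (finrank ℝ (GnoFol L) : ℝ))) * b)) ^ ((finrank ℝ (GnoFol L) : ℝ) / 2) = Y at R₁ R₂ R₃ ⊢
  generalize hIdef : (∫⁻ p : ℝ × ℝ, ENNReal.ofReal ((1 + δt ^ 2) ^ 2 / (1 + (p.1 ^ 2 / (1 + p.1 ^ 2) + p.2 ^ 2 / (1 + p.2 ^ 2)) * (1 + δt ^ 2)) *
      ((1 + p.1 ^ 2)⁻¹ * (1 + p.2 ^ 2)⁻¹ / Real.sqrt (LinearMap.det (A0 (gnoBase p.1 p.2)))))) = I at R₁ R₂ R₃ ⊢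
  have hX0 : 0 ≤ X := by rw [← hXdef]; exact Real.rpow_nonneg (by positivity) _
  have hY0 : 0 ≤ Y := by
    rw [← hYdef]
    have hd : (2 : ℝ) ≤ (finrank ℝ (GnoFol L) : ℝ) := by
      rw [finrank_gnoFol_real (L := L)]
      obtain ⟨-, hc1, -, -, -⟩ := cell_sizes (L := L)
      linarith
    have h1 : 0 ≤ 1 - 1 / (2 * (finrank ℝ (GnoFol L) : ℝ)) := by
      rw [sub_nonneg, div_le_one (by positivity)]; linarith
    exact Real.rpow_nonneg (by positivity) _
  -- split by the cover
  have hsplit := lintegral_le_of_cover3' (volume : Measure ((Fin 3 → ℝ) × (Fin 3 → ℝ)))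
    (fun xy : (Fin 3 → ℝ) × (Fin 3 → ℝ) => ∫⁻ z : Fin 3 → ℝ, ENNReal.ofReal (gnomonicWeight xy.1 * gnomonicWeight xy.2 * gnomonicWeight z) *
      ∫⁻ F : Fol L → Fin 3 → ℝ, ENNReal.ofReal (Real.exp (-(b * gnoDeficit (fun _ => false) (fun _ => 1) (hubAt δt 1) ε ((xy, (z, F)) : GnoCoord L))) * piWeight F))
    (S₁ := S₁ L δt) (S₂ := S₂ L δt) (S₃ := S₃ L δt) (hcover L δt)
  refine hsplit.trans ?_
  refine (add_le_add (add_le_add R₁ R₂) R₃).trans ?_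
  -- constants
  have hA : C₁ * (L : ℝ) ^ c₁ * X * Y + C₂ * (L : ℝ) ^ c₂ * X * Y + C₃ * (L : ℝ) ^ c₃ * X * Y ≤ (C₁ + C₂ + C₃) * (L : ℝ) ^ max c₁ (max c₂ c₃) * X * Y := by
    have h1 : C₁ * (L : ℝ) ^ c₁ ≤ C₁ * (L : ℝ) ^ max c₁ (max c₂ c₃) := mul_le_mul_of_nonneg_left (hLpow (le_max_left _ _)) hC₁.le
    have h2 : C₂ * (L : ℝ) ^ c₂ ≤ C₂ * (L : ℝ) ^ max c₁ (max c₂ c₃) :=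
      mul_le_mul_of_nonneg_left (hLpow ((le_max_left _ _).trans (le_max_right _ _))) hC₂.le
    have h3 : C₃ * (L : ℝ) ^ c₃ ≤ C₃ * (L : ℝ) ^ max c₁ (max c₂ c₃) :=
      mul_le_mul_of_nonneg_left (hLpow ((le_max_right _ _).trans (le_max_right _ _))) hC₃.le
    have hXY : 0 ≤ X * Y := mul_nonneg hX0 hY0
    have := mul_le_mul_of_nonneg_right (add_le_add (add_le_add h1 h2) h3) hXY
    nlinarith
  have htails := three_tails_le (L' := (L : ℝ)) (b := b) (C := max (max T₁ (max T₂ T₃)) 0) (Q := max Q₁ (max Q₂ Q₃)) (p := max p₁ (max p₂ p₃)) hL1 hbpos.le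
    (le_max_right _ _) ((le_max_left _ _).trans (le_max_left _ _)) (((le_max_left _ _).trans (le_max_right _ _)).trans (le_max_left _ _))
    (((le_max_right _ _).trans (le_max_right _ _)).trans (le_max_left _ _))
    hQ₁ hQ₂ hQ₃ (le_max_left _ _) ((le_max_left _ _).trans (le_max_right _ _)) ((le_max_right _ _).trans (le_max_right _ _))
    (le_max_left _ _) ((le_max_left _ _).trans (le_max_right _ _)) ((le_max_right _ _).trans (le_max_right _ _))
  have h0₁ : 0 ≤ C₁ * (L : ℝ) ^ c₁ * X * Y := by positivity
  have h0₂ : 0 ≤ C₂ * (L : ℝ) ^ c₂ * X * Y := by positivity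
  have h0₃ : 0 ≤ C₃ * (L : ℝ) ^ c₃ * X * Y := by positivity
  calc ENNReal.ofReal (C₁ * (L : ℝ) ^ c₁ * X * Y) * I + ENNReal.ofReal (Real.exp (T₁ * (L : ℝ) ^ p₁ - b / (Q₁ * (L : ℝ) ^ p₁))) +
        (ENNReal.ofReal (C₂ * (L : ℝ) ^ c₂ * X * Y) * I + ENNReal.ofReal (Real.exp (T₂ * (L : ℝ) ^ p₂ - b / (Q₂ * (L : ℝ) ^ p₂)))) +
        (ENNReal.ofReal (C₃ * (L : ℝ) ^ c₃ * X * Y) * I + ENNReal.ofReal (Real.exp (T₃ * (L : ℝ) ^ p₃ - b / (Q₃ * (L : ℝ) ^ p₃))))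
      = ENNReal.ofReal (C₁ * (L : ℝ) ^ c₁ * X * Y + C₂ * (L : ℝ) ^ c₂ * X * Y + C₃ * (L : ℝ) ^ c₃ * X * Y) * I +
        ENNReal.ofReal (Real.exp (T₁ * (L : ℝ) ^ p₁ - b / (Q₁ * (L : ℝ) ^ p₁)) + Real.exp (T₂ * (L : ℝ) ^ p₂ - b / (Q₂ * (L : ℝ) ^ p₂)) +
          Real.exp (T₃ * (L : ℝ) ^ p₃ - b / (Q₃ * (L : ℝ) ^ p₃))) := by
        rw [ENNReal.ofReal_add (by positivity) h0₃, ENNReal.ofReal_add h0₁ h0₂,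
          ENNReal.ofReal_add (by positivity) (Real.exp_pos _).le, ENNReal.ofReal_add (Real.exp_pos _).le (Real.exp_pos _).le]
        ring
    _ ≤ ENNReal.ofReal ((C₁ + C₂ + C₃) * (L : ℝ) ^ max c₁ (max c₂ c₃) * X * Y) * I +
        ENNReal.ofReal (Real.exp ((max (max T₁ (max T₂ T₃)) 0 + 2) * (L : ℝ) ^ max p₁ (max p₂ p₃) - b / (max Q₁ (max Q₂ Q₃) * (L : ℝ) ^ max p₁ (max p₂ p₃)))) := by
        gcongr

end Summit.QuantumFields.YangMills.Theorems.SwapVirialDeficit.SectorLaplace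

end
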